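import Summits.HodgeConjecture.HodgeConjecture.Theorems.H413E2SWEInvariance
import Literature.NumberTheory.Weil1964.AdelicDoublingGeometricFrameBorelMp
import Literature.NumberTheory.Automorphic.DoubledUnitaryRankOneReductionDiag
import HarnessLib

/-!
# H413 · E-2 · SW2 (iii) — (INV) IN FULL: isometric `E″`-invariant lifts of the rational points of the doubled `W`-member over the frame hom `j`

Cell `hodgecm-mathlib`, floor 0, programme P4, engine E-2, crux H413 (`stmt-HodgeConjecture-24833`, `--supports`); child line
`Cruxes/H413/Lines/F0_E2SiegelWeilWeilRange.lean`, open stub `stub_SW2iii_siegelWeil`; row (INV) of sheet `F0/P4/SW2c-BOUND-ASSEMBLY.v1` §B =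
the binder `hINV` of ★ `Theorems/H413E2SWBorelBound.exists_borelBound_of_lemma20` ∕ `…NarrowC.exists_borelBound_of_lemma20_of_dominated` ∕
F0P4-p07's A4 `Theorems/H413E2SWBorelBoundFrame.exists_borelBound_frame`, AT THE CELL'S HOM OF RECORD
`j = conj(π u₀ · π(r_F δ)) ∘ spReindex ∘ jS` (A4's binders `u₀ hu₀ jS hjS j hj` VERBATIM); seat F0P4-p02 (g4), E-2 lead lineage, 2026-08-31.
PROOF lane: theorems only, no definition, no notation, no `sorry`.  HC_CM is proved only modulo the printed citations until rung 0 closes; nothing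
here is about Hodge classes.

THE MATHEMATICS ([Weil1965] n° 47–50; [Weil1964] Chap. III n° 40–41).  Let `γ ∈ U_D(𝔸_F)` be `E`-rational, `U_D = U(T_W ⊕ −T_W)`.  Then
`γ = toAdelic w` for a rational `w` (★ `DoubledUnitary.RankOneReduction.mem_range_toAdelic_iff`), `ι_{eD}(1 ⊗ w) = ratSp γ̃` for a rational
symplectic `γ̃ ∈ Sp_{2(n+n)}(F)` (★ `exists_ratSp_coe_eq_toSp`, through ★ `adelicGram_doubled_eq_doubledGramFin`), and
`r := u₀ · r_F(δ γ̃ δ⁻¹) · u₀⁻¹ ∈ Mp_ψ(𝕎□_𝔸)ᶜᵒⁿᵗ` satisfies: `π(r) = π(u₀)·ratSp(δ γ̃ δ⁻¹)·π(u₀)⁻¹ = j γ`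
(★ `proj_conj_ratThetaLiftCont`, `hjS`), `L(r) = 1` (★ `l2Scaling_conj_ratThetaLiftCont`), and `E″ ∘ ω(r⁻¹) = E″` for every `E″` invariant in
the frame (§1, hypothesis `hEinv`) — in particular for `E″ := Λ_θ − ν([U(J_V)]) • E_X^ℂ` (★ ED. 2
`E2SWEInvariance.thetaOrbitFunctional_sub_smul_adelicSiegelFunctionalC_comp_omega_inv_conj_eq`, §2): the `hINV` binder DISCHARGED.

* §1 `exists_lift_of_mem_range` — `hINV` for any `E″` satisfying `hEinv : ∀ γ̃ ∈ IW(F), E″ ∘ ω((u₀ r_F(δγ̃δ⁻¹) u₀⁻¹)⁻¹) = E″`.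
* §2 `hINV_thetaOrbitFunctional_sub_smul_adelicSiegelFunctionalC` — `hINV` at `E″ := Λ_θ − ν(univ) • E_X^ℂ` (CM ∕ totally real, `2 < N`,
  Tamagawa `νX`, condition (B) `hB`), NO structure binder.

References: A. Weil, *Sur la formule de Siegel dans la théorie des groupes classiques*, Acta Math. 113 (1965), n° 47–50, n° 51–52 Thm 5
[Weil1965]; A. Weil, *Sur certains groupes d'opérateurs unitaires*, Acta Math. 111 (1964), Chap. I n° 13 p. 160, Chap. III n° 40–41 Thm 6 p. 193
[Weil1964]; S. Gelbart, I. Piatetski-Shapiro, S. Rallis, LNM 1254 (1987), Part A §2 pp. 7–9 [GelbartPiatetskishapiroRallis1987]; C. P. Mok,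
Mem. AMS 235 (2015), §1 Notation p. 5 [Mok2014].
-/

set_option autoImplicit false
-- the cell's `Summit.HodgeConjecture.HodgeConjecture.…` namespace repeats the summit name by design (D-0017 layout)
set_option linter.dupNamespace false

noncomputable section

open _root_.MeasureTheory NumberField
open Literature.RepresentationTheory.HeisenbergGroup
open Literature.NumberTheory.Weil1964 Literature.NumberTheory.Weil1964.DoublingFrame
open Literature.NumberTheory.Weil1965 Literature.NumberTheory.Weil1965.UnitaryDoubling
open Literature.NumberTheory.Automorphic
open Literature.NumberTheory.GelbartRogawski1991 Literature.NumberTheory.GelbartRogawski1991.UnitaryDualPair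

namespace Summit.HodgeConjecture.HodgeConjecture.Cruxes.H413.E2SWRationalLift

/-- group algebra: `a (d s d⁻¹) a⁻¹ = (a d) s (a d)⁻¹`. [folklore] -/
private theorem mul_conj_mul_inv_eq {G : Type*} [Group G] (a d s : G) : a * (d * s * d⁻¹) * a⁻¹ = a * d * s * (a * d)⁻¹ := by
  group

section Frame

variable (F E : Type) [Field F] [NumberField F] [Field E] [NumberField E] [Algebra F E] [Algebra.IsQuadraticExtension F E]
  (c : E ≃ₐ[F] E) {δ : E} (hcδ : c δ = -δ) (hδ : δ ≠ 0) {d : F} (hd : δ * δ = algebraMap F E d)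
  (N : ℕ) {n : ℕ} (e : Fin N × Fin 1 ≃ Fin n)
  (TV : Matrix (Fin N) (Fin N) F) (hV : TV.IsSymm) (hVd : IsUnit TV.det)
  (TW : Matrix (Fin 1) (Fin 1) F) (hW : TW.IsSymm) (hWd : IsUnit TW.det)
  (hW2 : (Matrix.reindex finSumFinEquiv finSumFinEquiv (Matrix.fromBlocks TW 0 0 (-TW))).IsSymm)
  -- the frame chirp as an element of `Mp` (★ `exists_frameUnipPair`)
  (u₀ : adelicMpCont F (Fin (n + n)) (doubledGramFin F (adelicGram F e TV TW)))
  -- the `W`-side hom into the sum model (A4's `jS`, `hjS` VERBATIM)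
  (jS : ↥(UnitaryGroup.adelic F E c (1 + 1)
      ((Matrix.reindex finSumFinEquiv finSumFinEquiv (Matrix.fromBlocks TW 0 0 (-TW))).map (algebraMap F E))) →*
    ↥(symplecticGroup (polar (Matrix.toLinearMap₂' (AdeleRing (𝓞 F) F)
      (Matrix.fromBlocks (adelicGram F e TV TW) 0 0 (-adelicGram F e TV TW))))))
  (hjS : ∀ (A : ↥(UnitaryGroup.adelic F E c (1 + 1)
      ((Matrix.reindex finSumFinEquiv finSumFinEquiv (Matrix.fromBlocks TW 0 0 (-TW))).map (algebraMap F E))))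
      (v : (Fin (n + n) → AdeleRing (𝓞 F) F) × (Fin (n + n) → AdeleRing (𝓞 F) F)),
    ((UnitaryGroup.spReindex (finSumFinEquiv : Fin n ⊕ Fin n ≃ Fin (n + n))
        (Matrix.fromBlocks (adelicGram F e TV TW) 0 0 (-adelicGram F e TV TW)) (jS A) :
        symplecticGroup (polar (Matrix.toLinearMap₂' (AdeleRing (𝓞 F) F)
          (Matrix.reindex finSumFinEquiv finSumFinEquiv
            (Matrix.fromBlocks (adelicGram F e TV TW) 0 0 (-adelicGram F e TV TW)))))) :
      ((Fin (n + n) → AdeleRing (𝓞 F) F) × (Fin (n + n) → AdeleRing (𝓞 F) F)) ≃ₗ[AdeleRing (𝓞 F) F]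
        ((Fin (n + n) → AdeleRing (𝓞 F) F) × (Fin (n + n) → AdeleRing (𝓞 F) F))) v =
    ((toSp F E c N (1 + 1)
        (((Equiv.prodCongr (Equiv.refl (Fin N)) finSumFinEquiv.symm).trans (Equiv.prodSumDistrib (Fin N) (Fin 1) (Fin 1))).trans
          ((Equiv.sumCongr e e).trans finSumFinEquiv))
        (TV.map (algebraMap F E)) ((Matrix.reindex finSumFinEquiv finSumFinEquiv (Matrix.fromBlocks TW 0 0 (-TW))).map (algebraMap F E))
        hcδ hδ hd hV hW2 rfl rfl
        (UnitaryGroup.adelicInr F E c N (1 + 1) (TV.map (algebraMap F E))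
          ((Matrix.reindex finSumFinEquiv finSumFinEquiv (Matrix.fromBlocks TW 0 0 (-TW))).map (algebraMap F E)) A) :
        symplecticGroup (polar (adelicForm F (Fin (n + n))
          (adelicGram F
            (((Equiv.prodCongr (Equiv.refl (Fin N)) finSumFinEquiv.symm).trans (Equiv.prodSumDistrib (Fin N) (Fin 1) (Fin 1))).trans
              ((Equiv.sumCongr e e).trans finSumFinEquiv)) TV
            (Matrix.reindex finSumFinEquiv finSumFinEquiv (Matrix.fromBlocks TW 0 0 (-TW))))))) :
      ((Fin (n + n) → AdeleRing (𝓞 F) F) × (Fin (n + n) → AdeleRing (𝓞 F) F)) ≃ₗ[AdeleRing (𝓞 F) F]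
        ((Fin (n + n) → AdeleRing (𝓞 F) F) × (Fin (n + n) → AdeleRing (𝓞 F) F))) v)
  -- THE HOM OF RECORD `j = conj(π u₀ · π(doublingDeltaLift)) ∘ spReindex ∘ jS` (A4's `j`, `hj` VERBATIM)
  (j : ↥(UnitaryGroup.adelic F E c (1 + 1)
      ((Matrix.reindex finSumFinEquiv finSumFinEquiv (Matrix.fromBlocks TW 0 0 (-TW))).map (algebraMap F E))) →*
    ↥(symplecticGroup (polar (adelicForm F (Fin (n + n)) (doubledGramFin F (adelicGram F e TV TW))))))
  (hj : j = (MulAut.conj (adelicMpCont.proj F (Fin (n + n)) (doubledGramFin F (adelicGram F e TV TW)) u₀ *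
      adelicMpCont.proj F (Fin (n + n)) (doubledGramFin F (adelicGram F e TV TW))
        (doublingDeltaLift F (adelicGram F e TV TW) (isUnit_det_adelicGram F e hVd hWd)))).toMonoidHom.comp
    ((UnitaryGroup.spReindex (finSumFinEquiv : Fin n ⊕ Fin n ≃ Fin (n + n))
      (Matrix.fromBlocks (adelicGram F e TV TW) 0 0 (-adelicGram F e TV TW))).comp jS))

include hWd hjS in
/-- **`spReindex (jS γ) = ratSp γ̃` in `Sp(𝕎□_𝔸)`** whenever `ι_{eD}(1 ⊗ w) = ratSp γ̃` and `γ = toAdelic w` (`hjS` + ★ `exists_ratSp_coe_eq_toSp`'s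
equation): the sum-model image of a rational point IS a rational symplectic matrix. [cite: GelbartPiatetskishapiroRallis1987, Part A §2 pp. 7–9] -/
theorem spReindex_jS_eq_ratSp
    (w : UnitaryGroup.rational F E c (1 + 1) ((Matrix.reindex finSumFinEquiv finSumFinEquiv (Matrix.fromBlocks TW 0 0 (-TW))).map (algebraMap F E)))
    (γs : Matrix.symplecticGroup (Fin (n + n)) F)
    (hγw : ((ratSp F (doubledGramFin F (adelicGram F e TV TW))
          (isUnit_det_doubledGramFin F _ (isUnit_det_adelicGram F e hVd hWd)) γs :
          symplecticGroup (polar (adelicForm F (Fin (n + n)) (doubledGramFin F (adelicGram F e TV TW))))) :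
        ((Fin (n + n) → AdeleRing (𝓞 F) F) × (Fin (n + n) → AdeleRing (𝓞 F) F)) ≃ₗ[AdeleRing (𝓞 F) F]
          ((Fin (n + n) → AdeleRing (𝓞 F) F) × (Fin (n + n) → AdeleRing (𝓞 F) F))) =
      ((toSp F E c N (1 + 1)
          (((Equiv.prodCongr (Equiv.refl (Fin N)) finSumFinEquiv.symm).trans (Equiv.prodSumDistrib (Fin N) (Fin 1) (Fin 1))).trans
            ((Equiv.sumCongr e e).trans finSumFinEquiv))
          (TV.map (algebraMap F E)) ((Matrix.reindex finSumFinEquiv finSumFinEquiv (Matrix.fromBlocks TW 0 0 (-TW))).map (algebraMap F E))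
          hcδ hδ hd hV hW2 rfl rfl
          (UnitaryGroup.adelicInr F E c N (1 + 1) (TV.map (algebraMap F E))
            ((Matrix.reindex finSumFinEquiv finSumFinEquiv (Matrix.fromBlocks TW 0 0 (-TW))).map (algebraMap F E))
            (UnitaryGroup.toAdelic F E c (1 + 1)
              ((Matrix.reindex finSumFinEquiv finSumFinEquiv (Matrix.fromBlocks TW 0 0 (-TW))).map (algebraMap F E)) w)) :
          symplecticGroup (polar (adelicForm F (Fin (n + n))
            (adelicGram F
              (((Equiv.prodCongr (Equiv.refl (Fin N)) finSumFinEquiv.symm).trans (Equiv.prodSumDistrib (Fin N) (Fin 1) (Fin 1))).trans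
                ((Equiv.sumCongr e e).trans finSumFinEquiv)) TV
              (Matrix.reindex finSumFinEquiv finSumFinEquiv (Matrix.fromBlocks TW 0 0 (-TW))))))) :
        ((Fin (n + n) → AdeleRing (𝓞 F) F) × (Fin (n + n) → AdeleRing (𝓞 F) F)) ≃ₗ[AdeleRing (𝓞 F) F]
          ((Fin (n + n) → AdeleRing (𝓞 F) F) × (Fin (n + n) → AdeleRing (𝓞 F) F)))) :
    UnitaryGroup.spReindex (finSumFinEquiv : Fin n ⊕ Fin n ≃ Fin (n + n))
        (Matrix.fromBlocks (adelicGram F e TV TW) 0 0 (-adelicGram F e TV TW))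
        (jS (UnitaryGroup.toAdelic F E c (1 + 1)
          ((Matrix.reindex finSumFinEquiv finSumFinEquiv (Matrix.fromBlocks TW 0 0 (-TW))).map (algebraMap F E)) w)) =
      ratSp F (doubledGramFin F (adelicGram F e TV TW)) (isUnit_det_doubledGramFin F _ (isUnit_det_adelicGram F e hVd hWd)) γs :=
  Subtype.ext (LinearEquiv.ext fun v =>
    (hjS (UnitaryGroup.toAdelic F E c (1 + 1)
        ((Matrix.reindex finSumFinEquiv finSumFinEquiv (Matrix.fromBlocks TW 0 0 (-TW))).map (algebraMap F E)) w) v).trans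
      (LinearEquiv.congr_fun hγw v).symm)

include hWd hjS hj in
/-- **(INV) FOR ANY FRAME-INVARIANT `E″`**: if `E″ ∘ ω((u₀ · r_F(δ γ̃ δ⁻¹) · u₀⁻¹)⁻¹) = E″` for every rational point `γ̃ ∈ IW(F)` of the doubled
`W`-member (the child's `ratDoubledW`, unfolded), then every `E`-rational `γ ∈ U_D(𝔸_F)` has a lift `r ∈ Mp_ψ(𝕎□_𝔸)ᶜᵒⁿᵗ` over `j γ` with `L(r) = 1` and
`E″ ∘ ω(r⁻¹) = E″` — the `hINV` binder of ★ `exists_borelBound_of_lemma20` at the hom of record `j`, for such `E″`.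
[cite: Weil1965, n° 47–50] [cite: Weil1964, Chap. III n° 40 p. 190] [cite: Mok2014, §1 Notation p. 5] -/
theorem exists_lift_of_mem_range [MeasurableSpace (AdeleRing (𝓞 F) F)] [BorelSpace (AdeleRing (𝓞 F) F)]
    (νX : Measure (Fin (n + n) → AdeleRing (𝓞 F) F)) [νX.IsAddHaarMeasure]
    (E'' : piSchwartzBruhat F (Fin (n + n)) →ₗ[ℂ] ℂ)
    (hEinv : ∀ γs : Matrix.symplecticGroup (Fin (n + n)) F,
      γs ∈ Subgroup.comap
        ((symplecticGroup (polar (adelicForm F (Fin (n + n)) (doubledGramFin F (adelicGram F e TV TW))))).subtype.comp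
          (ratSp F (doubledGramFin F (adelicGram F e TV TW)) (isUnit_det_doubledGramFin F _ (isUnit_det_adelicGram F e hVd hWd))))
        (MonoidHom.range
          ((symplecticGroup (polar (adelicForm F (Fin (n + n))
              (adelicGram F
                (((Equiv.prodCongr (Equiv.refl (Fin N)) finSumFinEquiv.symm).trans (Equiv.prodSumDistrib (Fin N) (Fin 1) (Fin 1))).trans
                  ((Equiv.sumCongr e e).trans finSumFinEquiv)) TV
                (Matrix.reindex finSumFinEquiv finSumFinEquiv (Matrix.fromBlocks TW 0 0 (-TW))))))).subtype.comp
            ((toSp F E c N (1 + 1)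
                (((Equiv.prodCongr (Equiv.refl (Fin N)) finSumFinEquiv.symm).trans (Equiv.prodSumDistrib (Fin N) (Fin 1) (Fin 1))).trans
                  ((Equiv.sumCongr e e).trans finSumFinEquiv))
                (TV.map (algebraMap F E)) ((Matrix.reindex finSumFinEquiv finSumFinEquiv (Matrix.fromBlocks TW 0 0 (-TW))).map (algebraMap F E))
                hcδ hδ hd hV hW2 rfl rfl).comp
              ((UnitaryGroup.adelicInr F E c N (1 + 1) (TV.map (algebraMap F E))
                  ((Matrix.reindex finSumFinEquiv finSumFinEquiv (Matrix.fromBlocks TW 0 0 (-TW))).map (algebraMap F E))).comp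
                (UnitaryGroup.toAdelic F E c (1 + 1)
                  ((Matrix.reindex finSumFinEquiv finSumFinEquiv (Matrix.fromBlocks TW 0 0 (-TW))).map (algebraMap F E))))))) →
      E'' ∘ₗ adelicMpCont.omega F (Fin (n + n)) (doubledGramFin F (adelicGram F e TV TW))
          (u₀ * ratThetaLiftCont F (doubledGramFin F (adelicGram F e TV TW))
              (isUnit_det_doubledGramFin F _ (isUnit_det_adelicGram F e hVd hWd))
              (doublingDeltaRat F * γs * (doublingDeltaRat F)⁻¹) * u₀⁻¹)⁻¹ = E'') :
    ∀ (γ : GL (Fin (1 + 1)) (AdeleRing (𝓞 E) E))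
      (hγ : γ ∈ UnitaryGroup.adelic F E c (1 + 1)
        ((Matrix.reindex finSumFinEquiv finSumFinEquiv (Matrix.fromBlocks TW 0 0 (-TW))).map (algebraMap F E))),
      γ ∈ (Matrix.GeneralLinearGroup.map (algebraMap E (AdeleRing (𝓞 E) E))).range →
      ∃ r : adelicMpCont F (Fin (n + n)) (doubledGramFin F (adelicGram F e TV TW)),
        adelicMpCont.proj F (Fin (n + n)) (doubledGramFin F (adelicGram F e TV TW)) r = j ⟨γ, hγ⟩ ∧
        adelicMpCont.l2Scaling F (doubledGramFin F (adelicGram F e TV TW))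
          (isUnit_det_doubledGramFin F (adelicGram F e TV TW) (isUnit_det_adelicGram F e hVd hWd)) νX r = 1 ∧
        E'' ∘ₗ adelicMpCont.omega F (Fin (n + n)) (doubledGramFin F (adelicGram F e TV TW)) r⁻¹ = E'' := by
  intro γ hγ hrange
  -- `γ = toAdelic w`, `w` rational (★ `mem_range_toAdelic_iff`); `ι_{eD}(1 ⊗ w) = ratSp γ̃`, `γ̃` rational symplectic (★ `exists_ratSp_coe_eq_toSp`)
  refine ((DoubledUnitary.RankOneReduction.mem_range_toAdelic_iff F E c
    ((Matrix.reindex finSumFinEquiv finSumFinEquiv (Matrix.fromBlocks TW 0 0 (-TW))).map (algebraMap F E)) ⟨γ, hγ⟩).mpr hrange).elim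
    fun w hw => ?_
  refine (UnitaryGroup.exists_ratSp_coe_eq_toSp F E c hcδ hδ hd N (1 + 1)
    (((Equiv.prodCongr (Equiv.refl (Fin N)) finSumFinEquiv.symm).trans (Equiv.prodSumDistrib (Fin N) (Fin 1) (Fin 1))).trans
      ((Equiv.sumCongr e e).trans finSumFinEquiv)) hV hW2 hVd
    (UnitaryGroup.isUnit_det_doubledLine F (hWd := hWd) (TW2 := Matrix.reindex finSumFinEquiv finSumFinEquiv (Matrix.fromBlocks TW 0 0 (-TW))) rfl)
    (doubledGramFin F (adelicGram F e TV TW)) (isUnit_det_doubledGramFin F _ (isUnit_det_adelicGram F e hVd hWd))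
    (UnitaryGroup.adelicGram_doubled_eq_doubledGramFin F N e (TV := TV) (TW := TW)
      (TW2 := Matrix.reindex finSumFinEquiv finSumFinEquiv (Matrix.fromBlocks TW 0 0 (-TW))) rfl) w).elim
    fun γs hγw => ?_
  -- the lift `r := u₀ · r_F(δ γ̃ δ⁻¹) · u₀⁻¹`
  refine ⟨u₀ * ratThetaLiftCont F (doubledGramFin F (adelicGram F e TV TW))
      (isUnit_det_doubledGramFin F _ (isUnit_det_adelicGram F e hVd hWd))
      (doublingDeltaRat F * γs * (doublingDeltaRat F)⁻¹) * u₀⁻¹, ?_, ?_, ?_⟩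
  · -- `π(r) = π(u₀) · ratSp(δ γ̃ δ⁻¹) · π(u₀)⁻¹ = (π u₀ · π(r_F δ)) · ratSp γ̃ · (π u₀ · π(r_F δ))⁻¹ = j γ` (term mode: no `rw` near lifts)
    have hsp : UnitaryGroup.spReindex (finSumFinEquiv : Fin n ⊕ Fin n ≃ Fin (n + n))
          (Matrix.fromBlocks (adelicGram F e TV TW) 0 0 (-adelicGram F e TV TW)) (jS ⟨γ, hγ⟩) =
        ratSp F (doubledGramFin F (adelicGram F e TV TW)) (isUnit_det_doubledGramFin F _ (isUnit_det_adelicGram F e hVd hWd)) γs :=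
      (congrArg (fun A => UnitaryGroup.spReindex (finSumFinEquiv : Fin n ⊕ Fin n ≃ Fin (n + n))
          (Matrix.fromBlocks (adelicGram F e TV TW) 0 0 (-adelicGram F e TV TW)) (jS A)) hw.symm).trans
        (spReindex_jS_eq_ratSp F E c hcδ hδ hd N e TV hV hVd TW hWd hW2 jS hjS w γs hγw)
    have hδ' : adelicMpCont.proj F (Fin (n + n)) (doubledGramFin F (adelicGram F e TV TW))
          (doublingDeltaLift F (adelicGram F e TV TW) (isUnit_det_adelicGram F e hVd hWd)) =
        ratSp F (doubledGramFin F (adelicGram F e TV TW)) (isUnit_det_doubledGramFin F _ (isUnit_det_adelicGram F e hVd hWd))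
          (doublingDeltaRat F) :=
      proj_ratThetaLiftCont F (doubledGramFin F (adelicGram F e TV TW)) (isUnit_det_doubledGramFin F _ (isUnit_det_adelicGram F e hVd hWd)) _
    have hrat : ratSp F (doubledGramFin F (adelicGram F e TV TW)) (isUnit_det_doubledGramFin F _ (isUnit_det_adelicGram F e hVd hWd))
          (doublingDeltaRat F * γs * (doublingDeltaRat F)⁻¹) =
        ratSp F (doubledGramFin F (adelicGram F e TV TW)) (isUnit_det_doubledGramFin F _ (isUnit_det_adelicGram F e hVd hWd))
            (doublingDeltaRat F) *
          ratSp F (doubledGramFin F (adelicGram F e TV TW)) (isUnit_det_doubledGramFin F _ (isUnit_det_adelicGram F e hVd hWd)) γs *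
          (ratSp F (doubledGramFin F (adelicGram F e TV TW)) (isUnit_det_doubledGramFin F _ (isUnit_det_adelicGram F e hVd hWd))
            (doublingDeltaRat F))⁻¹ :=
      (map_mul (ratSp F (doubledGramFin F (adelicGram F e TV TW)) (isUnit_det_doubledGramFin F _ (isUnit_det_adelicGram F e hVd hWd))) _ _).trans
        (congrArg₂ (· * ·)
          (map_mul (ratSp F (doubledGramFin F (adelicGram F e TV TW)) (isUnit_det_doubledGramFin F _ (isUnit_det_adelicGram F e hVd hWd))) _ _)
          (map_inv (ratSp F (doubledGramFin F (adelicGram F e TV TW)) (isUnit_det_doubledGramFin F _ (isUnit_det_adelicGram F e hVd hWd))) _))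
    -- `j γ` unfolded along `hj`
    have h4 : j ⟨γ, hγ⟩ =
        adelicMpCont.proj F (Fin (n + n)) (doubledGramFin F (adelicGram F e TV TW)) u₀ *
            adelicMpCont.proj F (Fin (n + n)) (doubledGramFin F (adelicGram F e TV TW))
              (doublingDeltaLift F (adelicGram F e TV TW) (isUnit_det_adelicGram F e hVd hWd)) *
          UnitaryGroup.spReindex (finSumFinEquiv : Fin n ⊕ Fin n ≃ Fin (n + n))
            (Matrix.fromBlocks (adelicGram F e TV TW) 0 0 (-adelicGram F e TV TW)) (jS ⟨γ, hγ⟩) *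
          (adelicMpCont.proj F (Fin (n + n)) (doubledGramFin F (adelicGram F e TV TW)) u₀ *
            adelicMpCont.proj F (Fin (n + n)) (doubledGramFin F (adelicGram F e TV TW))
              (doublingDeltaLift F (adelicGram F e TV TW) (isUnit_det_adelicGram F e hVd hWd)))⁻¹ := by
      subst hj
      rfl
    -- assemble
    refine (proj_conj_ratThetaLiftCont F (adelicGram F e TV TW) (isUnit_det_adelicGram F e hVd hWd) u₀
      (doublingDeltaRat F * γs * (doublingDeltaRat F)⁻¹)).trans ?_
    refine (congrArg (fun z => adelicMpCont.proj F (Fin (n + n)) (doubledGramFin F (adelicGram F e TV TW)) u₀ * z *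
      (adelicMpCont.proj F (Fin (n + n)) (doubledGramFin F (adelicGram F e TV TW)) u₀)⁻¹) hrat).trans ?_
    refine (mul_conj_mul_inv_eq _ _ _).trans (Eq.trans ?_ h4.symm)
    exact (congrArg₂ (fun a b => adelicMpCont.proj F (Fin (n + n)) (doubledGramFin F (adelicGram F e TV TW)) u₀ * a * b *
      (adelicMpCont.proj F (Fin (n + n)) (doubledGramFin F (adelicGram F e TV TW)) u₀ * a)⁻¹) hδ' hsp).symm
  · -- `L(r) = 1`
    exact l2Scaling_conj_ratThetaLiftCont F (adelicGram F e TV TW) (isUnit_det_adelicGram F e hVd hWd) νX u₀ _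
  · -- `E″ ∘ ω(r⁻¹) = E″`: `γ̃ ∈ IW(F)` by the witness `w`
    exact hEinv γs (Subgroup.mem_comap.mpr ⟨w, hγw.symm⟩)

end Frame

/-! ## §2 `hINV` at `E″ := Λ_θ − ν([U(J_V)]) • E_X^ℂ`: NO structure binder -/

section Unconditional

variable (F E : Type) [Field F] [NumberField F] [Field E] [NumberField E] [Algebra F E] [Algebra.IsQuadraticExtension F E]
  (c : E ≃ₐ[F] E) {δ : E} (hcδ : c δ = -δ) (hδ : δ ≠ 0) {d : F} (hd : δ * δ = algebraMap F E d)
  (N : ℕ) {n : ℕ} (e : Fin N × Fin 1 ≃ Fin n)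
  (TV : Matrix (Fin N) (Fin N) F) (hV : TV.IsSymm) (hVd : IsUnit TV.det)
  (TW : Matrix (Fin 1) (Fin 1) F) (hW : TW.IsSymm) (hWd : IsUnit TW.det)

/-- **(INV) DISCHARGED for `E″ := Λ_θ − ν([U(J_V)]) • E_X^ℂ`** (CM ∕ totally real, `2 < N`): every `E`-rational `γ ∈ U_D(𝔸_F)` has a lift
`r = u₀ · r_F(δ γ̃ δ⁻¹) · u₀⁻¹` over `j γ` with `L(r) = 1` and `E″ ∘ ω(r⁻¹) = E″` — §1 fed with ★ ED. 2
`E2SWEInvariance.thetaOrbitFunctional_sub_smul_adelicSiegelFunctionalC_comp_omega_inv_conj_eq`; the `hINV` binder of A4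
`exists_borelBound_frame` at this `E″`, token for token (`hW2 := E2SWOrbit.twd_isSymm F TW hW`).
[cite: Weil1965, n° 47–50 and n° 51–52 Thm 5] [cite: Weil1964, Chap. III n° 40–41 Thm 6 p. 193] -/
theorem hINV_thetaOrbitFunctional_sub_smul_adelicSiegelFunctionalC [IsTotallyReal F]
    [LocallyCompactSpace (UnitaryGroup.adelic F E c N (TV.map (algebraMap F E)))]
    [LocallyCompactSpace (UnitaryGroup.adelic F E c 1 (TW.map (algebraMap F E)))]
    (s : UnitaryGroup.adelicPair F E c N 1 (TV.map (algebraMap F E)) (TW.map (algebraMap F E)) →*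
      adelicMpCont F (Fin n) (adelicGram F e TV TW))
    (hs : (splittingDatum F E c N 1 e (TV.map (algebraMap F E)) (TW.map (algebraMap F E)) hcδ hδ hd hV hW hVd hWd rfl rfl).IsCompatible s)
    (hN : 2 < N)
    [CompactSpace (UnitaryGroup.adelic F E c N (TV.map (algebraMap F E)) ⧸ (UnitaryGroup.toAdelic F E c N (TV.map (algebraMap F E))).range)]
    [MeasurableSpace (UnitaryGroup.adelic F E c N (TV.map (algebraMap F E)) ⧸ (UnitaryGroup.toAdelic F E c N (TV.map (algebraMap F E))).range)]
    [BorelSpace (UnitaryGroup.adelic F E c N (TV.map (algebraMap F E)) ⧸ (UnitaryGroup.toAdelic F E c N (TV.map (algebraMap F E))).range)]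
    (νU : Measure (UnitaryGroup.adelic F E c N (TV.map (algebraMap F E)) ⧸ (UnitaryGroup.toAdelic F E c N (TV.map (algebraMap F E))).range))
    [IsFiniteMeasure νU]
    [MeasurableSpace (adeleQuotient F)] [BorelSpace (adeleQuotient F)]
    [MeasurableSpace (AdeleRing (𝓞 F) F)] [BorelSpace (AdeleRing (𝓞 F) F)]
    (νX : Measure (Fin (n + n) → AdeleRing (𝓞 F) F)) [νX.IsAddHaarMeasure] (hνX : νX (piFundamentalDomain F (Fin (n + n))) = 1)
    (hB : ∀ Φ ∈ piSchwartzBruhat F (Fin (n + n)),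
      Summable fun ξ : F => ‖adelicSiegelCoeff F (Fin (n + n)) νX (sdForm F (Literature.NumberTheory.Weil1964.ratMatrix F
        (Matrix.reindex finSumFinEquiv finSumFinEquiv (Matrix.fromBlocks (gram F e TV TW) 0 0 (-(d • (gram F e TV TW)⁻¹)))))) Φ ξ‖)
    (u₀ : adelicMpCont F (Fin (n + n)) (doubledGramFin F (adelicGram F e TV TW)))
    (hu₀ : ∀ Φ : piSchwartzBruhat F (Fin (n + n)),
      ((adelicMpCont.omega F (Fin (n + n)) (doubledGramFin F (adelicGram F e TV TW)) u₀ Φ : piSchwartzBruhat F (Fin (n + n))) :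
          (Fin (n + n) → AdeleRing (𝓞 F) F) → ℂ) =
        chirp F (ratMatrix F (frameHalfRat F)) (Φ : (Fin (n + n) → AdeleRing (𝓞 F) F) → ℂ))
    (jS : ↥(UnitaryGroup.adelic F E c (1 + 1)
        ((Matrix.reindex finSumFinEquiv finSumFinEquiv (Matrix.fromBlocks TW 0 0 (-TW))).map (algebraMap F E))) →*
      ↥(symplecticGroup (polar (Matrix.toLinearMap₂' (AdeleRing (𝓞 F) F)
        (Matrix.fromBlocks (adelicGram F e TV TW) 0 0 (-adelicGram F e TV TW))))))
    (hjS : ∀ (A : ↥(UnitaryGroup.adelic F E c (1 + 1)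
        ((Matrix.reindex finSumFinEquiv finSumFinEquiv (Matrix.fromBlocks TW 0 0 (-TW))).map (algebraMap F E))))
        (v : (Fin (n + n) → AdeleRing (𝓞 F) F) × (Fin (n + n) → AdeleRing (𝓞 F) F)),
      ((UnitaryGroup.spReindex (finSumFinEquiv : Fin n ⊕ Fin n ≃ Fin (n + n))
          (Matrix.fromBlocks (adelicGram F e TV TW) 0 0 (-adelicGram F e TV TW)) (jS A) :
          symplecticGroup (polar (Matrix.toLinearMap₂' (AdeleRing (𝓞 F) F)
            (Matrix.reindex finSumFinEquiv finSumFinEquiv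
              (Matrix.fromBlocks (adelicGram F e TV TW) 0 0 (-adelicGram F e TV TW)))))) :
        ((Fin (n + n) → AdeleRing (𝓞 F) F) × (Fin (n + n) → AdeleRing (𝓞 F) F)) ≃ₗ[AdeleRing (𝓞 F) F]
          ((Fin (n + n) → AdeleRing (𝓞 F) F) × (Fin (n + n) → AdeleRing (𝓞 F) F))) v =
      ((toSp F E c N (1 + 1)
          (((Equiv.prodCongr (Equiv.refl (Fin N)) finSumFinEquiv.symm).trans (Equiv.prodSumDistrib (Fin N) (Fin 1) (Fin 1))).trans
            ((Equiv.sumCongr e e).trans finSumFinEquiv))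
          (TV.map (algebraMap F E)) ((Matrix.reindex finSumFinEquiv finSumFinEquiv (Matrix.fromBlocks TW 0 0 (-TW))).map (algebraMap F E))
          hcδ hδ hd hV (E2SWOrbit.twd_isSymm F TW hW) rfl rfl
          (UnitaryGroup.adelicInr F E c N (1 + 1) (TV.map (algebraMap F E))
            ((Matrix.reindex finSumFinEquiv finSumFinEquiv (Matrix.fromBlocks TW 0 0 (-TW))).map (algebraMap F E)) A) :
          symplecticGroup (polar (adelicForm F (Fin (n + n))
            (adelicGram F
              (((Equiv.prodCongr (Equiv.refl (Fin N)) finSumFinEquiv.symm).trans (Equiv.prodSumDistrib (Fin N) (Fin 1) (Fin 1))).trans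
                ((Equiv.sumCongr e e).trans finSumFinEquiv)) TV
              (Matrix.reindex finSumFinEquiv finSumFinEquiv (Matrix.fromBlocks TW 0 0 (-TW))))))) :
        ((Fin (n + n) → AdeleRing (𝓞 F) F) × (Fin (n + n) → AdeleRing (𝓞 F) F)) ≃ₗ[AdeleRing (𝓞 F) F]
          ((Fin (n + n) → AdeleRing (𝓞 F) F) × (Fin (n + n) → AdeleRing (𝓞 F) F))) v)
    (j : ↥(UnitaryGroup.adelic F E c (1 + 1)
        ((Matrix.reindex finSumFinEquiv finSumFinEquiv (Matrix.fromBlocks TW 0 0 (-TW))).map (algebraMap F E))) →*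
      ↥(symplecticGroup (polar (adelicForm F (Fin (n + n)) (doubledGramFin F (adelicGram F e TV TW))))))
    (hj : j = (MulAut.conj (adelicMpCont.proj F (Fin (n + n)) (doubledGramFin F (adelicGram F e TV TW)) u₀ *
        adelicMpCont.proj F (Fin (n + n)) (doubledGramFin F (adelicGram F e TV TW))
          (doublingDeltaLift F (adelicGram F e TV TW) (isUnit_det_adelicGram F e hVd hWd)))).toMonoidHom.comp
      ((UnitaryGroup.spReindex (finSumFinEquiv : Fin n ⊕ Fin n ≃ Fin (n + n))
        (Matrix.fromBlocks (adelicGram F e TV TW) 0 0 (-adelicGram F e TV TW))).comp jS)) :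
    ∀ (γ : GL (Fin (1 + 1)) (AdeleRing (𝓞 E) E))
      (hγ : γ ∈ UnitaryGroup.adelic F E c (1 + 1)
        ((Matrix.reindex finSumFinEquiv finSumFinEquiv (Matrix.fromBlocks TW 0 0 (-TW))).map (algebraMap F E))),
      γ ∈ (Matrix.GeneralLinearGroup.map (algebraMap E (AdeleRing (𝓞 E) E))).range →
      ∃ r : adelicMpCont F (Fin (n + n)) (doubledGramFin F (adelicGram F e TV TW)),
        adelicMpCont.proj F (Fin (n + n)) (doubledGramFin F (adelicGram F e TV TW)) r = j ⟨γ, hγ⟩ ∧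
        adelicMpCont.l2Scaling F (doubledGramFin F (adelicGram F e TV TW))
          (isUnit_det_doubledGramFin F (adelicGram F e TV TW) (isUnit_det_adelicGram F e hVd hWd)) νX r = 1 ∧
        (thetaOrbitFunctional F E c hcδ hδ hd N e TV hV hVd TW hW hWd νU -
              ((νU Set.univ).toReal : ℂ) •
                adelicSiegelFunctionalC F (Fin (n + n)) νX (sdForm F (Literature.NumberTheory.Weil1964.ratMatrix F
                  (Matrix.reindex finSumFinEquiv finSumFinEquiv (Matrix.fromBlocks (gram F e TV TW) 0 0 (-(d • (gram F e TV TW)⁻¹))))))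
                  (E2SWEisDecomposition.continuous_sdForm F _) hB) ∘ₗ
            adelicMpCont.omega F (Fin (n + n)) (doubledGramFin F (adelicGram F e TV TW)) r⁻¹ =
          thetaOrbitFunctional F E c hcδ hδ hd N e TV hV hVd TW hW hWd νU -
            ((νU Set.univ).toReal : ℂ) •
              adelicSiegelFunctionalC F (Fin (n + n)) νX (sdForm F (Literature.NumberTheory.Weil1964.ratMatrix F
                (Matrix.reindex finSumFinEquiv finSumFinEquiv (Matrix.fromBlocks (gram F e TV TW) 0 0 (-(d • (gram F e TV TW)⁻¹))))))
                (E2SWEisDecomposition.continuous_sdForm F _) hB :=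
  exists_lift_of_mem_range F E c hcδ hδ hd N e TV hV hVd TW hWd (E2SWOrbit.twd_isSymm F TW hW) u₀ jS hjS j hj νX _
    fun _ hγs => E2SWEInvariance.thetaOrbitFunctional_sub_smul_adelicSiegelFunctionalC_comp_omega_inv_conj_eq F E c hcδ hδ hd N e
      TV hV hVd TW hW hWd s hs hN νU νX hνX hB u₀ hu₀ hγs

end Unconditional

end Summit.HodgeConjecture.HodgeConjecture.Cruxes.H413.E2SWRationalLift

end
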